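import Summits.CriticalPhenomena.PercolationContinuityZ3.Theorems.PercNearOneGluingNoHeavyQuantThetaHolderOfOneArm
import Summits.CriticalPhenomena.PercolationContinuityZ3.Theorems.PercNearOneGluingNoHeavyQuantThetaModulus
import Summits.CriticalPhenomena.PercolationContinuityZ3.Theorems.PercNearOneGluingNoHeavyQuantOneArm
import HarnessLib

/-!
# QUANT lane rung R4 in the lane's own vocabulary: `OneArmRateAtCritical ⇒ ThetaModulusNearCritical`,
# `OneArmPolyDecayAtCritical ⇒ ThetaHolderNearCritical (2c/(c+d))`, and the unconditional critical modulus

builds on p205010 (kernel theorem, internal audit signed; external expert review pending).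
Status sentence for p205010: "θ(p_c) = 0 on ℤ^d, all d ≥ 2 — kernel-verified (Lean 4/Mathlib, standard
axioms); internal adversarial audit SIGNED 2026-08-20 04:29Z; external expert review pending."

Seat `prim-quant-p4` (METHOD = differential inequalities), `--supports stmt-CriticalPhenomena-4575`; pure proofs.
The statements R0.b/R0.c (`Quant.OneArmRateAtCritical`, `Quant.ThetaModulusNearCritical`,
`Quant.ThetaHolderNearCritical`, typer seat `prim-quant-stmt`, file `PercNearOneGluingNoHeavyQuantThetaModulus.lean`)
and R0.a (`Quant.OneArmPolyDecayAtCritical`, `Quant.OneArmPolyDecay`, file `PercNearOneGluingNoHeavyQuantOneArm.lean`) are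
consumed verbatim; the analysis is in `PercNearOneGluingNoHeavyQuantThetaOneArmModulus.lean` (Moore–Shannon /
Chayes–Chayes–Fisher–Spencer influence bound, Grimmett 1999 Thm. (2.36)(a), integrated) and
`PercNearOneGluingNoHeavyQuantThetaHolderOfOneArm.lean` (the choice `n = ⌈(p − p_c)^{−2/(c+d)}⌉`).

* `thetaModulusNearCritical_critical` — UNCONDITIONAL: `ThetaModulusNearCritical d ω_d` for the explicit
  `ω_d(t) = inf_n (√π_{p_c}(n) + t·√(#ℰ(d,n)/(2p_c(1−p_c))))²` on `t ≤ (1−p_c)/2` (and `1` beyond); the limit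
  `ω_d(0⁺) = 0` is p205010 (`inf_n π_{p_c}(n) = θ(p_c) = 0`).  Explicit modulo the critical one-arm sequence.
* `thetaModulusNearCritical_of_oneArmRate` — R4.b: any explicit one-arm rate `f` at `p_c` gives the explicit modulus
  `ω_f(t) = inf_n (√f(n+1) + t·√(#ℰ(d,n+1)/(2p_c(1−p_c))))²` (`t ≤ (1−p_c)/2`; `1` beyond) — no use of p205010.
* `thetaHolderNearCritical_of_oneArmPolyDecay` — R4.b, Hölder case: `OneArmPolyDecayAtCritical d c C` (`c > 0`) gives
  `ThetaHolderNearCritical d (2c/(c+d)) C'`, `C' = (√C + √(4d·3^d/(p_c(1−p_c)))·2^{d/2}/2)² + (2/(1−p_c))^{2c/(c+d)}`;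
  and `OneArmPolyDecay d → ∃ b > 0, ∃ C', ThetaHolderNearCritical d b C'`.
* `thetaModulusNearCritical_of_holder` — bookkeeping: a Hölder bound with `b > 0` is a modulus.
* `theta_le_logModulus_of_oneArmLogDecay` — log-rate transfer: `π_{p_c}(n) ≤ A(log n)^{−a}` (the shape produced by the
  multiscale rung R3″ under its crossing-defect leaf) gives `θ(p) ≤ 2A d^a/log(1/(p−p_c))^a + (2d·5^d/(p_c(1−p_c)))(p−p_c)`.

Honest scope: no rate is proved; (T1) is open.  New: the reductions and their constants/exponent.
[cite: GrimmettPercolation1999, Thm. (2.36)(a)] for the printed input.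
-/

noncomputable section

namespace Summit.CriticalPhenomena.PercolationContinuityZ3.Theorems

namespace ThetaModulus

open MeasureTheory Set Filter Topology Literature.Probability.Percolation Literature.Probability.LatticeModels
open scoped Classical

variable {d : ℕ}

/-! ### A Hölder bound is a modulus -/

/-- Bookkeeping: `ThetaHolderNearCritical d b C` with `b > 0` gives `ThetaModulusNearCritical d (t ↦ C t^b)`
(`C · t^b → 0` as `t → 0⁺`).  New (trivial). -/
theorem thetaModulusNearCritical_of_holder {b C : ℝ} (hb : 0 < b) (h : Quant.ThetaHolderNearCritical d b C) :
    Quant.ThetaModulusNearCritical d (fun t => C * t ^ b) := by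
  refine ⟨?_, fun p hp => h p hp⟩
  have hcont : Continuous fun t : ℝ => C * t ^ b := continuous_const.mul (Real.continuous_rpow_const hb.le)
  have h0 : C * (0 : ℝ) ^ b = 0 := by rw [Real.zero_rpow hb.ne', mul_zero]
  have := (hcont.tendsto 0).mono_left (nhdsWithin_le_nhds (s := Ici (0 : ℝ)))
  rwa [h0] at this

/-! ### The unconditional critical modulus (explicit modulo `π_{p_c}(n)`; limit by p205010) -/

/-- **`ThetaModulusNearCritical d ω_d`, unconditionally, for the explicit critical modulus**
`ω_d(t) = inf_n (√π_{p_c}(n) + t·√(#ℰ(d,n)/(2p_c(1−p_c))))²` for `t ≤ (1−p_c)/2` and `ω_d(t) = 1` beyond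
(`θ ≤ 1`).  The bound is `theta_le_ciInf_critical` (Moore–Shannon/CCFS integrated, new); `ω_d(0⁺) = 0` is
`tendsto_ciInf_critical`, i.e. p205010.  Explicit modulo the critical one-arm numbers `π_{p_c}(n)`; an explicit
rate for them makes `ω_d` explicit (`thetaModulusNearCritical_of_oneArmRate`, `thetaHolderNearCritical_of_oneArmPolyDecay`).
builds on p205010 (kernel theorem, internal audit signed; external expert review pending). -/
theorem thetaModulusNearCritical_critical (hd : 2 ≤ d) :
    Quant.ThetaModulusNearCritical d (fun t =>
      if t ≤ (1 - (criticalProbI d : ℝ)) / 2 then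
        ⨅ n : ℕ, (Real.sqrt (oneArmProb d (criticalProbI d) n) +
          t * Real.sqrt (((box d n).sym2.filter (· ∈ (zdGraph d).edgeSet)).card / (2 * (criticalProbI d : ℝ) * (1 - criticalProbI d)))) ^ 2
      else 1) := by
  have hpc1 : (criticalProbI d : ℝ) < 1 := by
    rw [coe_criticalProbI]; exact criticalProb_zd_lt_one hd
  refine ⟨?_, fun p hp => ?_⟩
  · -- near `0` the modulus is the infimum, which tends to `0` (p205010)
    have hev : ∀ᶠ t in 𝓝 (0 : ℝ), t ≤ (1 - (criticalProbI d : ℝ)) / 2 :=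
      eventually_le_nhds (by linarith)
    refine ((tendsto_ciInf_critical hd).congr' ?_).mono_left nhdsWithin_le_nhds
    filter_upwards [hev] with t ht
    rw [if_pos ht]
  · dsimp only
    by_cases ht : (p : ℝ) - criticalProbI d ≤ (1 - (criticalProbI d : ℝ)) / 2
    · rw [if_pos ht]
      exact theta_le_ciInf_critical hd p hp (by linarith)
    · rw [if_neg ht]
      exact theta_le_one _ _ _

/-! ### R4.b: an explicit one-arm rate at `p_c` gives an explicit modulus -/

/-- **R4.b (`OneArmRateAtCritical ⇒ ThetaModulusNearCritical`).**  If `π_{p_c}(n) ≤ f(n)` for `n ≥ 1` with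
`f → 0`, then `θ(p) ≤ ω_f(p − p_c)` for all `p ≥ p_c`, where
`ω_f(t) = inf_n (√f(n+1) + t·√(#ℰ(d,n+1)/(2p_c(1−p_c))))²` for `t ≤ (1−p_c)/2` and `ω_f(t) = 1` beyond, and
`ω_f(t) → 0` as `t → 0⁺` — WITHOUT p205010 (the rate replaces it).  New; the hypothesis is open for every
explicit `f` when `3 ≤ d ≤ 6`. -/
theorem thetaModulusNearCritical_of_oneArmRate (hd : 2 ≤ d) {f : ℕ → ℝ}
    (hf : Quant.OneArmRateAtCritical d f) :
    Quant.ThetaModulusNearCritical d (fun t =>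
      if t ≤ (1 - (criticalProbI d : ℝ)) / 2 then
        ⨅ n : ℕ, (Real.sqrt (f (n + 1)) +
          t * Real.sqrt (((box d (n + 1)).sym2.filter (· ∈ (zdGraph d).edgeSet)).card / (2 * (criticalProbI d : ℝ) * (1 - criticalProbI d)))) ^ 2
      else 1) := by
  obtain ⟨hlim, hle⟩ := hf
  have hpc1 : (criticalProbI d : ℝ) < 1 := by
    rw [coe_criticalProbI]; exact criticalProb_zd_lt_one hd
  set K : ℕ → ℝ := fun n =>
    Real.sqrt (((box d (n + 1)).sym2.filter (· ∈ (zdGraph d).edgeSet)).card / (2 * (criticalProbI d : ℝ) * (1 - criticalProbI d))) with hK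
  set g : ℕ → ℝ → ℝ := fun n t => (Real.sqrt (f (n + 1)) + t * K n) ^ 2 with hg
  have hg0 : ∀ n t, 0 ≤ g n t := fun n t => sq_nonneg _
  have hbdd : ∀ t, BddBelow (Set.range fun n => g n t) := fun t =>
    ⟨0, by rintro _ ⟨n, rfl⟩; exact hg0 n t⟩
  have hf0 : ∀ n, 0 ≤ f (n + 1) := fun n =>
    le_trans (by unfold oneArmProb; exact measureReal_nonneg) (hle (n + 1) (by omega))
  -- the infimum tends to `0` (from `f → 0`)
  have htend : Tendsto (fun t => ⨅ n, g n t) (𝓝 0) (𝓝 0) := by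
    rw [tendsto_order]
    refine ⟨fun a ha => Eventually.of_forall fun t => lt_of_lt_of_le ha (le_ciInf fun n => hg0 n t),
      fun b hb => ?_⟩
    obtain ⟨N, hN⟩ := (Filter.tendsto_atTop'.1 hlim) (Iio b) (Iio_mem_nhds hb)
    have hn : f (N + 1) < b := hN (N + 1) (by omega)
    have hcont : Continuous (g N) := by
      simp only [hg]
      fun_prop
    have hgN0 : g N 0 = f (N + 1) := by
      simp only [hg, zero_mul, add_zero]
      exact Real.sq_sqrt (hf0 N)
    have hev : ∀ᶠ t in 𝓝 (0 : ℝ), g N t < b := by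
      have hl : Tendsto (g N) (𝓝 0) (𝓝 (g N 0)) := hcont.tendsto 0
      exact hl.eventually (eventually_lt_nhds (by rw [hgN0]; exact hn))
    exact hev.mono fun t ht => lt_of_le_of_lt (ciInf_le (hbdd t) N) ht
  refine ⟨?_, fun p hp => ?_⟩
  · have hev : ∀ᶠ t in 𝓝 (0 : ℝ), t ≤ (1 - (criticalProbI d : ℝ)) / 2 :=
      eventually_le_nhds (by linarith)
    refine (htend.congr' ?_).mono_left nhdsWithin_le_nhds
    filter_upwards [hev] with t ht
    rw [if_pos ht]
  · dsimp only
    by_cases ht : (p : ℝ) - criticalProbI d ≤ (1 - (criticalProbI d : ℝ)) / 2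
    · rw [if_pos ht]
      refine le_ciInf fun n => ?_
      have hs : 0 ≤ (p : ℝ) - criticalProbI d := by linarith
      have h1 := theta_le_sq_sqrt_oneArm_critical hd p hp (by linarith) (n + 1)
      refine h1.trans (pow_le_pow_left₀ (by positivity) ?_ 2)
      have hπf : Real.sqrt (oneArmProb d (criticalProbI d) (n + 1)) ≤ Real.sqrt (f (n + 1)) :=
        Real.sqrt_le_sqrt (hle (n + 1) (by omega))
      show Real.sqrt (oneArmProb d (criticalProbI d) (n + 1)) +
          ((p : ℝ) - criticalProbI d) *
            Real.sqrt (((box d (n + 1)).sym2.filter (· ∈ (zdGraph d).edgeSet)).card / (2 * (criticalProbI d : ℝ) * (1 - criticalProbI d))) ≤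
        Real.sqrt (f (n + 1)) + ((p : ℝ) - criticalProbI d) * K n
      rw [hK]
      linarith
    · rw [if_neg ht]
      exact theta_le_one _ _ _

/-! ### R4.b, Hölder case: `OneArmPolyDecayAtCritical d c C ⇒ ThetaHolderNearCritical d (2c/(c+d)) C'` -/

/-- **R4.b, Hölder case.**  `OneArmPolyDecayAtCritical d c C` with `c > 0` implies
`ThetaHolderNearCritical d (2c/(c+d)) C'` with the explicit
`C' = (√C + √(4d·3^d/(p_c(1−p_c)))·2^{d/2}/2)² + (2/(1−p_c))^{2c/(c+d)}`
(`theta_le_holder_of_oneArmDecay`; `C ≥ 0` is forced by the hypothesis at `n = 1`).  Conditional on (T1); new.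
builds on p205010 (kernel theorem, internal audit signed; external expert review pending) (only at `p = p_c`). -/
theorem thetaHolderNearCritical_of_oneArmPolyDecay (hd : 2 ≤ d) {c C : ℝ} (hc : 0 < c)
    (h : Quant.OneArmPolyDecayAtCritical d c C) :
    Quant.ThetaHolderNearCritical d (2 * c / (c + d))
      ((Real.sqrt C + Real.sqrt (4 * d * 3 ^ d / ((criticalProbI d : ℝ) * (1 - criticalProbI d))) *
          2 ^ ((d : ℝ) / 2) / 2) ^ 2 + (2 / (1 - (criticalProbI d : ℝ))) ^ (2 * c / (c + d))) := by
  have hdecay : ∀ n : ℕ, 1 ≤ n → oneArmProb d (criticalProbI d) n ≤ C * (n : ℝ) ^ (-c) :=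
    fun n hn => h n hn
  have hC : 0 ≤ C := by
    have h1 := hdecay 1 le_rfl
    simp only [Nat.cast_one, Real.one_rpow, mul_one] at h1
    exact le_trans (by unfold oneArmProb; exact measureReal_nonneg) h1
  intro p hp
  exact theta_le_holder_of_oneArmDecay hd hc hC hdecay p hp

/-- **`OneArmPolyDecay d ⇒ ∃ b > 0, ∃ C', ThetaHolderNearCritical d b C'`** (existential form of R4.b; `b = 2c/(c+d)`).
Conditional on (T1); new. -/
theorem exists_thetaHolderNearCritical_of_oneArmPolyDecay (hd : 2 ≤ d) (h : Quant.OneArmPolyDecay d) :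
    ∃ b : ℝ, 0 < b ∧ ∃ C' : ℝ, Quant.ThetaHolderNearCritical d b C' := by
  obtain ⟨c, hc, C, hcC⟩ := h
  have hd0 : (0 : ℝ) < d := by exact_mod_cast (show 0 < d by omega)
  exact ⟨2 * c / (c + d), by positivity, _, thetaHolderNearCritical_of_oneArmPolyDecay hd hc hcC⟩

/-- **`OneArmPolyDecay d ⇒` an explicit (Hölder) `ThetaModulusNearCritical`** — the lane's (T1) ⇒ (T2).
Conditional on (T1); new. -/
theorem exists_thetaModulusNearCritical_of_oneArmPolyDecay (hd : 2 ≤ d) (h : Quant.OneArmPolyDecay d) :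
    ∃ b C' : ℝ, 0 < b ∧ Quant.ThetaModulusNearCritical d (fun t => C' * t ^ b) := by
  obtain ⟨b, hb, C', hH⟩ := exists_thetaHolderNearCritical_of_oneArmPolyDecay hd h
  exact ⟨b, C', hb, thetaModulusNearCritical_of_holder hb hH⟩

/-! ### A polylogarithmic one-arm rate gives a `1/log` modulus (composes with rung R3″) -/

/-- **Log-rate transfer.**  If the critical one-arm probabilities satisfy `π_{p_c}(n) ≤ A (log n)^{−a}` for all
`n ≥ 2` (`a > 0`; the output shape of the lane's multiscale rung R3″,
`Quant.oneArmProb_le_const_mul_log_rpow_neg`, itself conditional on a crossing-defect leaf), then for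
`p_c < p ≤ (1 + p_c)/2`,
`θ(p) ≤ 2A·d^a·(log(1/(p − p_c)))^{−a} + (2d·5^d/(p_c(1 − p_c)))·(p − p_c)`
(take `n = ⌈(p − p_c)^{−1/d}⌉` in `theta_le_sq_sqrt_oneArm_critical`).  So any polylog one-arm rate yields the
explicit modulus `ω(t) = C₁/log(1/t)^a + C₂ t`.  Conditional; the reduction is new. -/
theorem theta_le_logModulus_of_oneArmLogDecay (hd : 2 ≤ d) {a A : ℝ} (ha : 0 < a) (hA : 0 ≤ A)
    (hdecay : ∀ n : ℕ, 2 ≤ n → oneArmProb d (criticalProbI d) n ≤ A * (Real.log n) ^ (-a))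
    (p : unitInterval) (hpc : (criticalProbI d : ℝ) < p) (hp : (p : ℝ) ≤ (1 + criticalProbI d) / 2) :
    theta (zdGraph d) 0 p ≤
      2 * A * (d : ℝ) ^ a * (Real.log (1 / ((p : ℝ) - criticalProbI d))) ^ (-a) +
        2 * d * 5 ^ d / ((criticalProbI d : ℝ) * (1 - criticalProbI d)) * ((p : ℝ) - criticalProbI d) := by
  have hpc0 : 0 < (criticalProbI d : ℝ) := by
    rw [coe_criticalProbI]; exact criticalProb_zd_pos d (by omega)
  have hpc1 : (criticalProbI d : ℝ) < 1 := by
    rw [coe_criticalProbI]; exact criticalProb_zd_lt_one hd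
  set pc := (criticalProbI d : ℝ) with hpcdef
  set s := (p : ℝ) - pc with hsdef
  have hs0 : 0 < s := by rw [hsdef]; linarith
  have hs1 : s < 1 := by rw [hsdef]; linarith
  have hd0 : (0 : ℝ) < d := by exact_mod_cast (show 0 < d by omega)
  have hd1 : (1 : ℝ) ≤ d := by exact_mod_cast (show 1 ≤ d by omega)
  -- the scale `n = ⌈s^{-1/d}⌉ ≥ 2`
  set x : ℝ := s ^ (-(1 / (d : ℝ))) with hx
  have hx1 : 1 < x := by
    rw [hx, Real.rpow_neg hs0.le, ← Real.inv_rpow hs0.le]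
    exact Real.one_lt_rpow ((one_lt_inv₀ hs0).2 hs1) (by positivity)
  have hx0 : 0 < x := zero_lt_one.trans hx1
  set n : ℕ := ⌈x⌉₊ with hndef
  have hnx : x ≤ (n : ℝ) := Nat.le_ceil _
  have hn2 : 2 ≤ n := by
    have h1 : (1 : ℝ) < (n : ℝ) := hx1.trans_le hnx
    have : 1 < n := by exact_mod_cast h1
    omega
  have hn0 : 0 < (n : ℝ) := by exact_mod_cast (show 0 < n by omega)
  have hnle : (n : ℝ) ≤ 2 * x := by
    have := Nat.ceil_lt_add_one hx0.le
    rw [← hndef] at this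
    linarith
  -- main inequality at the scale `n`, then `(u + v)² ≤ 2u² + 2v²`
  have hmain := theta_le_sq_sqrt_oneArm_critical hd p hpc.le hp n
  set K := Real.sqrt (((box d n).sym2.filter (· ∈ (zdGraph d).edgeSet)).card / (2 * pc * (1 - pc))) with hKdef
  have hπ0 : 0 ≤ oneArmProb d (criticalProbI d) n := by unfold oneArmProb; exact measureReal_nonneg
  have hK0 : 0 ≤ K := Real.sqrt_nonneg _
  have hsq : (Real.sqrt (oneArmProb d (criticalProbI d) n) + s * K) ^ 2 ≤
      2 * oneArmProb d (criticalProbI d) n + 2 * (s * K) ^ 2 := by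
    nlinarith [sq_nonneg (Real.sqrt (oneArmProb d (criticalProbI d) n) - s * K),
      Real.sq_sqrt hπ0]
  -- first term: `π_n ≤ A (log n)^{-a} ≤ A d^a (log (1/s))^{-a}`
  have hlogs : 0 < Real.log (1 / s) := Real.log_pos ((one_lt_div hs0).2 hs1)
  have hlogx : Real.log x = (1 / (d : ℝ)) * Real.log (1 / s) := by
    rw [hx, Real.log_rpow hs0, one_div s, Real.log_inv]; ring
  have hlogn : (1 / (d : ℝ)) * Real.log (1 / s) ≤ Real.log n := by
    rw [← hlogx]; exact Real.log_le_log hx0 hnx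
  have hlogn0 : 0 < (1 / (d : ℝ)) * Real.log (1 / s) := by positivity
  have h1 : oneArmProb d (criticalProbI d) n ≤ A * (d : ℝ) ^ a * (Real.log (1 / s)) ^ (-a) := by
    calc oneArmProb d (criticalProbI d) n ≤ A * (Real.log n) ^ (-a) := hdecay n hn2
      _ ≤ A * ((1 / (d : ℝ)) * Real.log (1 / s)) ^ (-a) :=
          mul_le_mul_of_nonneg_left (Real.rpow_le_rpow_of_nonpos hlogn0 hlogn (by linarith)) hA
      _ = A * (d : ℝ) ^ a * (Real.log (1 / s)) ^ (-a) := by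
          rw [Real.mul_rpow (by positivity) hlogs.le, one_div, Real.inv_rpow hd0.le, Real.rpow_neg hd0.le,
            inv_inv]
          ring
  -- second term: `(s K)² = s² #E/(2 p_c (1-p_c)) ≤ s² · 2d (2n+1)^d/(2 p_c(1-p_c))`, `(2n+1)^d ≤ 5^d / s`
  have hE : ((((box d n).sym2.filter (· ∈ (zdGraph d).edgeSet)).card : ℝ)) ≤ 2 * d * ((2 * n + 1 : ℕ) : ℝ) ^ d := by
    exact_mod_cast card_boxEdges_le d n
  have hden : 0 < 2 * pc * (1 - pc) := by nlinarith
  have hK2 : K ^ 2 = (((box d n).sym2.filter (· ∈ (zdGraph d).edgeSet)).card : ℝ) / (2 * pc * (1 - pc)) := by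
    rw [hKdef, Real.sq_sqrt (div_nonneg (Nat.cast_nonneg _) hden.le)]
  have hxd : x ^ (d : ℕ) = 1 / s := by
    rw [hx, ← Real.rpow_natCast, ← Real.rpow_mul hs0.le]
    rw [show -(1 / (d : ℝ)) * (d : ℝ) = -1 by field_simp]
    rw [Real.rpow_neg_one, one_div]
  have h2n1 : ((2 * n + 1 : ℕ) : ℝ) ^ d ≤ 5 ^ d / s := by
    have hle5 : ((2 * n + 1 : ℕ) : ℝ) ≤ 5 * x := by push_cast; linarith
    calc ((2 * n + 1 : ℕ) : ℝ) ^ d ≤ (5 * x) ^ d := pow_le_pow_left₀ (by positivity) hle5 d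
      _ = 5 ^ d * x ^ d := mul_pow _ _ _
      _ = 5 ^ d / s := by rw [hxd]; ring
  have h2 : (s * K) ^ 2 ≤ d * 5 ^ d / (pc * (1 - pc)) * s := by
    rw [mul_pow, hK2]
    have hpc' : 0 < pc * (1 - pc) := by nlinarith
    calc s ^ 2 * ((((box d n).sym2.filter (· ∈ (zdGraph d).edgeSet)).card : ℝ) / (2 * pc * (1 - pc)))
        ≤ s ^ 2 * (2 * d * ((2 * n + 1 : ℕ) : ℝ) ^ d / (2 * pc * (1 - pc))) :=
          mul_le_mul_of_nonneg_left (div_le_div_of_nonneg_right hE hden.le) (sq_nonneg s)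
      _ ≤ s ^ 2 * (2 * d * (5 ^ d / s) / (2 * pc * (1 - pc))) := by
          apply mul_le_mul_of_nonneg_left _ (sq_nonneg s)
          apply div_le_div_of_nonneg_right _ hden.le
          exact mul_le_mul_of_nonneg_left h2n1 (by positivity)
      _ = d * 5 ^ d / (pc * (1 - pc)) * s := by
          field_simp
  calc theta (zdGraph d) 0 p
      ≤ (Real.sqrt (oneArmProb d (criticalProbI d) n) + s * K) ^ 2 := hmain
    _ ≤ 2 * oneArmProb d (criticalProbI d) n + 2 * (s * K) ^ 2 := hsq
    _ ≤ 2 * (A * (d : ℝ) ^ a * (Real.log (1 / s)) ^ (-a)) + 2 * (d * 5 ^ d / (pc * (1 - pc)) * s) := by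
        linarith [h1, h2]
    _ = 2 * A * (d : ℝ) ^ a * (Real.log (1 / s)) ^ (-a) + 2 * d * 5 ^ d / (pc * (1 - pc)) * s := by ring

end ThetaModulus

end Summit.CriticalPhenomena.PercolationContinuityZ3.Theorems
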